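import Summits.CriticalPhenomena.PercolationContinuityZ3.Theorems.PercNearOneGluingNoHeavyLowerTailCILTwoGateReach
import HarnessLib

/-!
# `NoHeavyLowerTail` (stmt-CriticalPhenomena-4575) — an observer set with at most TWO GATES: lightness and bookkeeping

Support file (prover `prim-gen-induct`, blob-quotient / cumulative-isolation line, gen 3; `--supports
stmt-CriticalPhenomena-4575`).  No definitions, no named facts, no sorries.  Second of three files; notation as in
`…CILTwoGateReach` (`ξ`, `~'`, `Γ`, `R`, `θ = μ(R)`), relays `A` disjoint from `S`, level `j`,
`I_K(x) = μ{|π'(x)| ≤ j}`, and `G(x) = μ(x ~' {y,z}, |π'({y,z})| ≤ j) + μ(x ≁' {y,z}, |π'(x)| ≤ j)` = the lightness of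
`x` in `K` with `y, z` glued.

* `TwoGate.lightness_eq` — **`I_w(x) = θ·G(x) + (1 − θ)·I_K(x)`** for every `x ∉ S` (from `reach_iff`: the edges meeting
  `S` act on the other clusters only through the event `R`, which is independent of `ξ`);
* `TwoGate.measureReal_R_le_gateEq_pair` — `θ ≤ ρ := μ{Γ = {y,z}}`;
* `TwoGate.setL_add_near`, `setR_add_near_singleton`, `setL_empty`, `setR_empty` — the bookkeeping behind the witness
  shift `Δ_K(T, x) − Δ_K(T, x') = J^T(x) − J^T(x')` (`J^{u} = I_K`, `J^{y,z} = G`) and the empty observer set;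
* `TwoGate.affine_mono`, `sum_flat_bound`, `sum_le_of_termwise` — the real arithmetic of the one-parameter argument:
  `d_K < 0`, `0 ≤ (1−θ)d_K + θ d_G`, `θ ≤ ρ` ⇒ `0 ≤ (1−ρ)d_K + ρ d_G`, and the summation skeleton of the flat bound.
-/

noncomputable section

namespace Summit.CriticalPhenomena.PercolationContinuityZ3.Theorems

open MeasureTheory Set Literature.Probability.LatticeModels Literature.Probability.Percolation
open scoped Classical BigOperators

variable {n : ℕ}

namespace CutObserver

namespace TwoGate

/-! ### Lightness of a relay with two gates -/

/-- **Lightness with two gates.**  Under `N(S) ⊆ {y,z}`, for a vertex `x ∉ S` (relays `A` disjoint from `S`):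
`I_w(x) = θ·G(x) + (1 − θ)·I_K(x)` with `θ = μ(R)`, `G(x) = μ(x ~' {y,z}, |π'({y,z})| ≤ j) + μ(x ≁' {y,z}, |π'(x)| ≤ j)`
(lightness in `K` with `y, z` glued) and `I_K(x) = μ{|π'(x)| ≤ j}`. [folklore] -/
theorem lightness_eq (w : Sym2 (Fin n) → unitInterval) (A S : Finset (Fin n)) {y z : Fin n} (x : Fin n) (j : ℕ)
    (hSA : Disjoint S A) (hxS : x ∉ S)
    (hsupp : ∀ v ∈ S, ∀ u, u ∉ S → w s(v, u) ≠ 0 → u = y ∨ u = z) :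
    (prodBernoulli w).real {ω : BondConfig (Fin n) | (A.filter fun a => ω ∈ openConn x a).card ≤ j} =
      (prodBernoulli w).real {ω : BondConfig (Fin n) | (openGraph (ω ∩ {e | ∃ v ∈ S, v ∈ e})).Reachable y z} *
          ((prodBernoulli w).real {ω : BondConfig (Fin n) |
              (∃ u ∈ ({y, z} : Finset (Fin n)), (openGraph (ω ∩ {e | ∀ v ∈ S, v ∉ e})).Reachable x u) ∧
                (A.filter fun a => ∃ u ∈ ({y, z} : Finset (Fin n)),
                  (openGraph (ω ∩ {e | ∀ v ∈ S, v ∉ e})).Reachable u a).card ≤ j} +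
            (prodBernoulli w).real {ω : BondConfig (Fin n) |
              (∀ u ∈ ({y, z} : Finset (Fin n)), ¬ (openGraph (ω ∩ {e | ∀ v ∈ S, v ∉ e})).Reachable x u) ∧
                (A.filter fun a => (openGraph (ω ∩ {e | ∀ v ∈ S, v ∉ e})).Reachable x a).card ≤ j}) +
        (1 - (prodBernoulli w).real
            {ω : BondConfig (Fin n) | (openGraph (ω ∩ {e | ∃ v ∈ S, v ∈ e})).Reachable y z}) *
          (prodBernoulli w).real {ω : BondConfig (Fin n) |
            (A.filter fun a => (openGraph (ω ∩ {e | ∀ v ∈ S, v ∉ e})).Reachable x a).card ≤ j} := by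
  haveI : IsProbabilityMeasure (prodBernoulli w) := inferInstance
  set μ := prodBernoulli w with hμ
  set R := {ω : BondConfig (Fin n) | (openGraph (ω ∩ {e | ∃ v ∈ S, v ∈ e})).Reachable y z} with hR
  set Lx := {ω : BondConfig (Fin n) | (A.filter fun a => ω ∈ openConn x a).card ≤ j} with hLx
  set EB := {ω : BondConfig (Fin n) |
    (∃ u ∈ ({y, z} : Finset (Fin n)), (openGraph (ω ∩ {e | ∀ v ∈ S, v ∉ e})).Reachable x u) ∧
      (A.filter fun a => ∃ u ∈ ({y, z} : Finset (Fin n)),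
        (openGraph (ω ∩ {e | ∀ v ∈ S, v ∉ e})).Reachable u a).card ≤ j} with hEB
  set EF := {ω : BondConfig (Fin n) |
    (∀ u ∈ ({y, z} : Finset (Fin n)), ¬ (openGraph (ω ∩ {e | ∀ v ∈ S, v ∉ e})).Reachable x u) ∧
      (A.filter fun a => (openGraph (ω ∩ {e | ∀ v ∈ S, v ∉ e})).Reachable x a).card ≤ j} with hEF
  set EK := {ω : BondConfig (Fin n) |
    (A.filter fun a => (openGraph (ω ∩ {e | ∀ v ∈ S, v ∉ e})).Reachable x a).card ≤ j} with hEK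
  set supp := {ω : BondConfig (Fin n) | ∀ e ∈ ω, w e ≠ 0} with hsuppdef
  -- pointwise identity on the support
  have hpt : Lx ∩ supp = ((R ∩ EB ∪ R ∩ EF) ∪ Rᶜ ∩ EK) ∩ supp := by
    ext ω
    simp only [mem_inter_iff, mem_union, mem_compl_iff]
    constructor
    · rintro ⟨hL, hω⟩
      refine ⟨?_, hω⟩
      have hΓ := gate_cases_of_support w hsupp hω
      by_cases hRω : ω ∈ R
      · by_cases hnear : ∃ u ∈ ({y, z} : Finset (Fin n)), (openGraph (ω ∩ {e | ∀ v ∈ S, v ∉ e})).Reachable x u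
        · -- `π(x) = π'({y,z})`
          have hfilt : (A.filter fun a => ω ∈ openConn x a) =
              (A.filter fun a => ∃ u ∈ ({y, z} : Finset (Fin n)),
                (openGraph (ω ∩ {e | ∀ v ∈ S, v ∉ e})).Reachable u a) := by
            refine Finset.filter_congr fun a ha => ?_
            have haS : a ∉ S := fun h => Finset.disjoint_left.1 hSA h ha
            rw [show (ω ∈ openConn x a) = (openGraph ω).Reachable x a from rfl, reach_iff hΓ hxS haS]
            obtain ⟨u₀, hu₀, hxu₀⟩ := hnear
            constructor
            · rintro (h | ⟨-, -, h⟩)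
              · exact ⟨u₀, hu₀, hxu₀.symm.trans h⟩
              · exact h
            · intro h; exact Or.inr ⟨hRω, ⟨u₀, hu₀, hxu₀⟩, h⟩
          refine Or.inl (Or.inl ⟨hRω, hnear, ?_⟩)
          rw [← hfilt]; exact hL
        · have hfilt : (A.filter fun a => ω ∈ openConn x a) =
              (A.filter fun a => (openGraph (ω ∩ {e | ∀ v ∈ S, v ∉ e})).Reachable x a) := by
            refine Finset.filter_congr fun a ha => ?_
            have haS : a ∉ S := fun h => Finset.disjoint_left.1 hSA h ha
            rw [show (ω ∈ openConn x a) = (openGraph ω).Reachable x a from rfl, reach_iff hΓ hxS haS]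
            constructor
            · rintro (h | ⟨-, h, -⟩)
              · exact h
              · exact absurd h hnear
            · exact fun h => Or.inl h
          refine Or.inl (Or.inr ⟨hRω, ?_, ?_⟩)
          · intro u hu hxu; exact hnear ⟨u, hu, hxu⟩
          · rw [← hfilt]; exact hL
      · have hfilt : (A.filter fun a => ω ∈ openConn x a) =
            (A.filter fun a => (openGraph (ω ∩ {e | ∀ v ∈ S, v ∉ e})).Reachable x a) := by
          refine Finset.filter_congr fun a ha => ?_
          have haS : a ∉ S := fun h => Finset.disjoint_left.1 hSA h ha
          rw [show (ω ∈ openConn x a) = (openGraph ω).Reachable x a from rfl, reach_iff hΓ hxS haS]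
          constructor
          · rintro (h | ⟨h, -, -⟩)
            · exact h
            · exact absurd h hRω
          · exact fun h => Or.inl h
        refine Or.inr ⟨hRω, ?_⟩
        show (A.filter fun a => (openGraph (ω ∩ {e | ∀ v ∈ S, v ∉ e})).Reachable x a).card ≤ j
        rw [← hfilt]; exact hL
    · rintro ⟨hU, hω⟩
      refine ⟨?_, hω⟩
      have hΓ := gate_cases_of_support w hsupp hω
      show (A.filter fun a => ω ∈ openConn x a).card ≤ j
      rcases hU with (⟨hRω, hnear, hcard⟩ | ⟨hRω, hfar, hcard⟩) | ⟨hRω, hcard⟩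
      · have hfilt : (A.filter fun a => ω ∈ openConn x a) =
            (A.filter fun a => ∃ u ∈ ({y, z} : Finset (Fin n)),
              (openGraph (ω ∩ {e | ∀ v ∈ S, v ∉ e})).Reachable u a) := by
          refine Finset.filter_congr fun a ha => ?_
          have haS : a ∉ S := fun h => Finset.disjoint_left.1 hSA h ha
          rw [show (ω ∈ openConn x a) = (openGraph ω).Reachable x a from rfl, reach_iff hΓ hxS haS]
          obtain ⟨u₀, hu₀, hxu₀⟩ := hnear
          constructor
          · rintro (h | ⟨-, -, h⟩)
            · exact ⟨u₀, hu₀, hxu₀.symm.trans h⟩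
            · exact h
          · intro h; exact Or.inr ⟨hRω, ⟨u₀, hu₀, hxu₀⟩, h⟩
        rw [hfilt]; exact hcard
      · have hfilt : (A.filter fun a => ω ∈ openConn x a) =
            (A.filter fun a => (openGraph (ω ∩ {e | ∀ v ∈ S, v ∉ e})).Reachable x a) := by
          refine Finset.filter_congr fun a ha => ?_
          have haS : a ∉ S := fun h => Finset.disjoint_left.1 hSA h ha
          rw [show (ω ∈ openConn x a) = (openGraph ω).Reachable x a from rfl, reach_iff hΓ hxS haS]
          constructor
          · rintro (h | ⟨-, ⟨u, hu, hxu⟩, -⟩)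
            · exact h
            · exact absurd hxu (hfar u hu)
          · exact fun h => Or.inl h
        rw [hfilt]; exact hcard
      · have hfilt : (A.filter fun a => ω ∈ openConn x a) =
            (A.filter fun a => (openGraph (ω ∩ {e | ∀ v ∈ S, v ∉ e})).Reachable x a) := by
          refine Finset.filter_congr fun a ha => ?_
          have haS : a ∉ S := fun h => Finset.disjoint_left.1 hSA h ha
          rw [show (ω ∈ openConn x a) = (openGraph ω).Reachable x a from rfl, reach_iff hΓ hxS haS]
          constructor
          · rintro (h | ⟨h, -, -⟩)
            · exact h
            · exact absurd h hRω
          · exact fun h => Or.inl h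
        rw [hfilt]; exact hcard
  -- measures
  have hdisj1 : Disjoint (R ∩ EB) (R ∩ EF) := by
    rw [Set.disjoint_left]
    rintro ω ⟨-, ⟨u, hu, hxu⟩, -⟩ ⟨-, hfar, -⟩
    exact hfar u hu hxu
  have hdisj2 : Disjoint (R ∩ EB ∪ R ∩ EF) (Rᶜ ∩ EK) := by
    rw [Set.disjoint_left]
    rintro ω hω ⟨hRc, -⟩
    rcases hω with ⟨hRω, -⟩ | ⟨hRω, -⟩ <;> exact hRc hRω
  have hRc : Rᶜ = {ω : BondConfig (Fin n) | ¬ (openGraph (ω ∩ {e | ∃ v ∈ S, v ∈ e})).Reachable y z} := by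
    ext ω; simp only [hR, mem_compl_iff, mem_setOf_eq]
  have hind1 : μ.real (R ∩ EB) = μ.real R * μ.real EB :=
    measureReal_on_inter_off w S (fun σ => (openGraph σ).Reachable y z) (fun ξ =>
      (∃ u ∈ ({y, z} : Finset (Fin n)), (openGraph ξ).Reachable x u) ∧
        (A.filter fun a => ∃ u ∈ ({y, z} : Finset (Fin n)), (openGraph ξ).Reachable u a).card ≤ j)
  have hind2 : μ.real (R ∩ EF) = μ.real R * μ.real EF :=
    measureReal_on_inter_off w S (fun σ => (openGraph σ).Reachable y z) (fun ξ =>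
      (∀ u ∈ ({y, z} : Finset (Fin n)), ¬ (openGraph ξ).Reachable x u) ∧
        (A.filter fun a => (openGraph ξ).Reachable x a).card ≤ j)
  have hind3 : μ.real (Rᶜ ∩ EK) = μ.real Rᶜ * μ.real EK := by
    rw [hRc]
    exact measureReal_on_inter_off w S (fun σ => ¬ (openGraph σ).Reachable y z) (fun ξ =>
      (A.filter fun a => (openGraph ξ).Reachable x a).card ≤ j)
  have hcompl : μ.real Rᶜ = 1 - μ.real R := probReal_compl_eq_one_sub MeasurableSet.of_discrete
  calc μ.real Lx = μ.real (Lx ∩ supp) := (measureReal_inter_support w Lx).symm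
    _ = μ.real (((R ∩ EB ∪ R ∩ EF) ∪ Rᶜ ∩ EK) ∩ supp) := by rw [hpt]
    _ = μ.real ((R ∩ EB ∪ R ∩ EF) ∪ Rᶜ ∩ EK) := measureReal_inter_support w _
    _ = μ.real (R ∩ EB) + μ.real (R ∩ EF) + μ.real (Rᶜ ∩ EK) := by
        rw [measureReal_union hdisj2 MeasurableSet.of_discrete, measureReal_union hdisj1 MeasurableSet.of_discrete]
    _ = μ.real R * (μ.real EB + μ.real EF) + (1 - μ.real R) * μ.real EK := by
        rw [hind1, hind2, hind3, hcompl]; ring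

/-- **`θ ≤ ρ`**: `μ(R) ≤ μ{Γ = {y,z}}` (`y ≠ z`, `y, z ∉ S`, `N(S) ⊆ {y,z}`). [folklore] -/
theorem measureReal_R_le_gateEq_pair (w : Sym2 (Fin n) → unitInterval) (S : Finset (Fin n)) {y z : Fin n}
    (hyz : y ≠ z) (hy : y ∉ S) (hz : z ∉ S)
    (hsupp : ∀ v ∈ S, ∀ u, u ∉ S → w s(v, u) ≠ 0 → u = y ∨ u = z) :
    (prodBernoulli w).real {ω : BondConfig (Fin n) | (openGraph (ω ∩ {e | ∃ v ∈ S, v ∈ e})).Reachable y z} ≤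
      (prodBernoulli w).real
        {ω : BondConfig (Fin n) | (Finset.univ.filter fun u => u ∉ S ∧ ∃ v ∈ S, s(u, v) ∈ ω) = {y, z}} := by
  rw [← measureReal_inter_support w]
  refine measureReal_mono (fun ω hω => ?_) (measure_ne_top _ _)
  exact gateEq_pair_of_R (gate_cases_of_support w hsupp hω.2) hyz hy hz hω.1

/-! ### Bookkeeping in `K`: the witness-shift identities -/

/-- `μ(x ≁' T, 1 ≤ |π'(T)| ≤ j) + μ(x ~' T, |π'(T)| ≤ j) = μ(1 ≤ |π'(T)| ≤ j)` for a relay `x` (configuration `ω ∩ D`).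
[folklore] -/
theorem setL_add_near (w : Sym2 (Fin n) → unitInterval) (A T : Finset (Fin n)) (D : Set (Sym2 (Fin n))) {x : Fin n}
    (hx : x ∈ A) (j : ℕ) :
    (prodBernoulli w).real {ω : BondConfig (Fin n) |
        (∀ u ∈ T, ¬ (openGraph (ω ∩ D)).Reachable x u) ∧
          1 ≤ (A.filter fun a => ∃ u ∈ T, (openGraph (ω ∩ D)).Reachable u a).card ∧
          (A.filter fun a => ∃ u ∈ T, (openGraph (ω ∩ D)).Reachable u a).card ≤ j} +
      (prodBernoulli w).real {ω : BondConfig (Fin n) |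
        (∃ u ∈ T, (openGraph (ω ∩ D)).Reachable x u) ∧
          (A.filter fun a => ∃ u ∈ T, (openGraph (ω ∩ D)).Reachable u a).card ≤ j} =
      (prodBernoulli w).real {ω : BondConfig (Fin n) |
        1 ≤ (A.filter fun a => ∃ u ∈ T, (openGraph (ω ∩ D)).Reachable u a).card ∧
          (A.filter fun a => ∃ u ∈ T, (openGraph (ω ∩ D)).Reachable u a).card ≤ j} := by
  have hdisj : Disjoint
      {ω : BondConfig (Fin n) |
        (∀ u ∈ T, ¬ (openGraph (ω ∩ D)).Reachable x u) ∧
          1 ≤ (A.filter fun a => ∃ u ∈ T, (openGraph (ω ∩ D)).Reachable u a).card ∧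
          (A.filter fun a => ∃ u ∈ T, (openGraph (ω ∩ D)).Reachable u a).card ≤ j}
      {ω : BondConfig (Fin n) |
        (∃ u ∈ T, (openGraph (ω ∩ D)).Reachable x u) ∧
          (A.filter fun a => ∃ u ∈ T, (openGraph (ω ∩ D)).Reachable u a).card ≤ j} := by
    rw [Set.disjoint_left]
    rintro ω ⟨hfar, -, -⟩ ⟨⟨u, hu, hxu⟩, -⟩
    exact hfar u hu hxu
  rw [← measureReal_union hdisj MeasurableSet.of_discrete]
  congr 1
  ext ω
  simp only [mem_union, mem_setOf_eq]
  constructor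
  · rintro (⟨-, h1, h2⟩ | ⟨⟨u, hu, hxu⟩, h2⟩)
    · exact ⟨h1, h2⟩
    · refine ⟨Finset.card_pos.2 ⟨x, Finset.mem_filter.2 ⟨hx, u, hu, hxu.symm⟩⟩, h2⟩
  · rintro ⟨h1, h2⟩
    by_cases hnear : ∃ u ∈ T, (openGraph (ω ∩ D)).Reachable x u
    · exact Or.inr ⟨hnear, h2⟩
    · refine Or.inl ⟨fun u hu hxu => hnear ⟨u, hu, hxu⟩, h1, h2⟩

/-- `μ(x ≁' u₀, |π'(x)| ≤ j) + μ(x ~' u₀, |π'({u₀})| ≤ j) = μ{|π'(x)| ≤ j}`: the glued lightness for a one-point set is the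
plain lightness (configuration `ω ∩ D`). [folklore] -/
theorem setR_add_near_singleton (w : Sym2 (Fin n) → unitInterval) (A : Finset (Fin n)) (D : Set (Sym2 (Fin n)))
    (x u₀ : Fin n) (j : ℕ) :
    (prodBernoulli w).real {ω : BondConfig (Fin n) |
        (∀ u ∈ ({u₀} : Finset (Fin n)), ¬ (openGraph (ω ∩ D)).Reachable x u) ∧
          (A.filter fun a => (openGraph (ω ∩ D)).Reachable x a).card ≤ j} +
      (prodBernoulli w).real {ω : BondConfig (Fin n) |
        (∃ u ∈ ({u₀} : Finset (Fin n)), (openGraph (ω ∩ D)).Reachable x u) ∧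
          (A.filter fun a => ∃ u ∈ ({u₀} : Finset (Fin n)), (openGraph (ω ∩ D)).Reachable u a).card ≤ j} =
      (prodBernoulli w).real {ω : BondConfig (Fin n) |
        (A.filter fun a => (openGraph (ω ∩ D)).Reachable x a).card ≤ j} := by
  have hdisj : Disjoint
      {ω : BondConfig (Fin n) |
        (∀ u ∈ ({u₀} : Finset (Fin n)), ¬ (openGraph (ω ∩ D)).Reachable x u) ∧
          (A.filter fun a => (openGraph (ω ∩ D)).Reachable x a).card ≤ j}
      {ω : BondConfig (Fin n) |
        (∃ u ∈ ({u₀} : Finset (Fin n)), (openGraph (ω ∩ D)).Reachable x u) ∧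
          (A.filter fun a => ∃ u ∈ ({u₀} : Finset (Fin n)), (openGraph (ω ∩ D)).Reachable u a).card ≤ j} := by
    rw [Set.disjoint_left]
    rintro ω ⟨hfar, -⟩ ⟨⟨u, hu, hxu⟩, -⟩
    exact hfar u hu hxu
  rw [← measureReal_union hdisj MeasurableSet.of_discrete]
  congr 1
  ext ω
  simp only [mem_union, mem_setOf_eq, Finset.mem_singleton, forall_eq, exists_eq_left]
  constructor
  · rintro (⟨-, h⟩ | ⟨hxu, h⟩)
    · exact h
    · have hfilt : (A.filter fun a => (openGraph (ω ∩ D)).Reachable x a) =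
          (A.filter fun a => (openGraph (ω ∩ D)).Reachable u₀ a) :=
        Finset.filter_congr fun a _ => ⟨fun h => hxu.symm.trans h, fun h => hxu.trans h⟩
      rw [hfilt]; exact h
  · intro h
    by_cases hxu : (openGraph (ω ∩ D)).Reachable x u₀
    · have hfilt : (A.filter fun a => (openGraph (ω ∩ D)).Reachable x a) =
          (A.filter fun a => (openGraph (ω ∩ D)).Reachable u₀ a) :=
        Finset.filter_congr fun a _ => ⟨fun h => hxu.symm.trans h, fun h => hxu.trans h⟩
      refine Or.inr ⟨hxu, ?_⟩
      rw [← hfilt]; exact h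
    · exact Or.inl ⟨hxu, h⟩

/-- The left event for the empty observer set is empty. [folklore] -/
theorem setL_empty (w : Sym2 (Fin n) → unitInterval) (A : Finset (Fin n)) (D : Set (Sym2 (Fin n))) (x : Fin n)
    (j : ℕ) :
    (prodBernoulli w).real {ω : BondConfig (Fin n) |
        (∀ u ∈ (∅ : Finset (Fin n)), ¬ (openGraph (ω ∩ D)).Reachable x u) ∧
          1 ≤ (A.filter fun a => ∃ u ∈ (∅ : Finset (Fin n)), (openGraph (ω ∩ D)).Reachable u a).card ∧
          (A.filter fun a => ∃ u ∈ (∅ : Finset (Fin n)), (openGraph (ω ∩ D)).Reachable u a).card ≤ j} = 0 := by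
  have hempty : {ω : BondConfig (Fin n) |
      (∀ u ∈ (∅ : Finset (Fin n)), ¬ (openGraph (ω ∩ D)).Reachable x u) ∧
        1 ≤ (A.filter fun a => ∃ u ∈ (∅ : Finset (Fin n)), (openGraph (ω ∩ D)).Reachable u a).card ∧
        (A.filter fun a => ∃ u ∈ (∅ : Finset (Fin n)), (openGraph (ω ∩ D)).Reachable u a).card ≤ j} = ∅ := by
    ext ω
    simp only [mem_setOf_eq, mem_empty_iff_false, iff_false, not_and]
    intro _ h1
    have h0 : (A.filter fun a => ∃ u ∈ (∅ : Finset (Fin n)), (openGraph (ω ∩ D)).Reachable u a).card = 0 := by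
      rw [Finset.card_eq_zero, Finset.filter_eq_empty_iff]
      rintro a - ⟨u, hu, -⟩
      exact absurd hu (Finset.notMem_empty u)
    omega
  rw [hempty, measureReal_empty]

/-- The right event for the empty observer set is the plain lightness event. [folklore] -/
theorem setR_empty (w : Sym2 (Fin n) → unitInterval) (A : Finset (Fin n)) (D : Set (Sym2 (Fin n))) (x : Fin n)
    (j : ℕ) :
    (prodBernoulli w).real {ω : BondConfig (Fin n) |
        (∀ u ∈ (∅ : Finset (Fin n)), ¬ (openGraph (ω ∩ D)).Reachable x u) ∧
          (A.filter fun a => (openGraph (ω ∩ D)).Reachable x a).card ≤ j} =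
      (prodBernoulli w).real {ω : BondConfig (Fin n) |
        (A.filter fun a => (openGraph (ω ∩ D)).Reachable x a).card ≤ j} := by
  congr 1
  ext ω
  simp only [mem_setOf_eq, Finset.notMem_empty, false_implies, implies_true, true_and]

/-! ### Real arithmetic of the one-parameter argument -/

/-- **Monotonicity along the one-parameter gluing family**: if `d_K < 0`, `0 ≤ (1−θ)d_K + θ d_G`, `0 ≤ θ ≤ ρ`, then
`0 ≤ (1−ρ)d_K + ρ d_G`. [folklore] -/
theorem affine_mono {dK dG θ ρ : ℝ} (hdK : dK < 0) (h : 0 ≤ (1 - θ) * dK + θ * dG) (hθ : 0 ≤ θ) (hθρ : θ ≤ ρ) :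
    0 ≤ (1 - ρ) * dK + ρ * dG := by
  have h1 : 0 ≤ dG - dK := by
    by_contra hneg
    push Not at hneg
    have : θ * (dG - dK) ≤ 0 := mul_nonpos_of_nonneg_of_nonpos hθ hneg.le
    nlinarith
  nlinarith [mul_le_mul_of_nonneg_right hθρ h1]

/-- **Summation skeleton of the flat bound.**  Nonnegative weights `q` summing to `1` over `𝒴 ∋ Y₁`; if
`d_K ≤ r Y − ℓ Y` for `Y ≠ Y₁`, `d_G ≤ r Y₁ − ℓ Y₁`, and `0 ≤ (1 − q Y₁) d_K + q Y₁ d_G`, then `Σ q·ℓ ≤ Σ q·r`. [folklore] -/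
theorem sum_flat_bound {ι : Type*} (𝒴 : Finset ι) {Y₁ : ι} (hY₁ : Y₁ ∈ 𝒴) (q ℓ r : ι → ℝ) (hq : ∀ Y ∈ 𝒴, 0 ≤ q Y)
    (hq1 : ∑ Y ∈ 𝒴, q Y = 1) {dK dG : ℝ} (hterm : ∀ Y ∈ 𝒴, Y ≠ Y₁ → dK ≤ r Y - ℓ Y) (hY₁term : dG ≤ r Y₁ - ℓ Y₁)
    (hfinal : 0 ≤ (1 - q Y₁) * dK + q Y₁ * dG) :
    ∑ Y ∈ 𝒴, q Y * ℓ Y ≤ ∑ Y ∈ 𝒴, q Y * r Y := by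
  classical
  rw [← sub_nonneg, ← Finset.sum_sub_distrib]
  have hrw : ∑ Y ∈ 𝒴, (q Y * r Y - q Y * ℓ Y) = ∑ Y ∈ 𝒴, q Y * (r Y - ℓ Y) :=
    Finset.sum_congr rfl fun Y _ => by ring
  rw [hrw, ← Finset.add_sum_erase 𝒴 _ hY₁]
  have herase : ∑ Y ∈ 𝒴.erase Y₁, q Y = 1 - q Y₁ := by
    have := Finset.add_sum_erase 𝒴 q hY₁
    linarith
  have h2 : (1 - q Y₁) * dK ≤ ∑ Y ∈ 𝒴.erase Y₁, q Y * (r Y - ℓ Y) := by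
    rw [← herase, Finset.sum_mul]
    refine Finset.sum_le_sum fun Y hY => ?_
    exact mul_le_mul_of_nonneg_left (hterm Y (Finset.mem_of_mem_erase hY) (Finset.ne_of_mem_erase hY))
      (hq Y (Finset.mem_of_mem_erase hY))
  have h1 : q Y₁ * dG ≤ q Y₁ * (r Y₁ - ℓ Y₁) := mul_le_mul_of_nonneg_left hY₁term (hq Y₁ hY₁)
  linarith

/-- Summation skeleton, trivial case: termwise `ℓ ≤ r` with nonnegative weights. [folklore] -/
theorem sum_le_of_termwise {ι : Type*} (𝒴 : Finset ι) (q ℓ r : ι → ℝ) (hq : ∀ Y ∈ 𝒴, 0 ≤ q Y)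
    (h : ∀ Y ∈ 𝒴, ℓ Y ≤ r Y) : ∑ Y ∈ 𝒴, q Y * ℓ Y ≤ ∑ Y ∈ 𝒴, q Y * r Y :=
  Finset.sum_le_sum fun Y hY => mul_le_mul_of_nonneg_left (h Y hY) (hq Y hY)

end TwoGate

end CutObserver

end Summit.CriticalPhenomena.PercolationContinuityZ3.Theorems

end
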